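import Literature.Geometry.Riemannian.StereographicConformal
import Literature.Geometry.Lorentzian.HypersurfaceConformal
import Literature.Geometry.Riemannian.MeanConvexContractibleProofs
import HarnessLib

/-!
# Mean-convex domains of Euclidean space carry PSC metrics with mean-convex boundary (the big-sphere trick)
(topic `Geometry/Riemannian`)

Proof file for the named fact `Literature.Geometry.Riemannian.Sweeney2026_pscMeanConvex`
(`MeanConvexContractible.lean`; Sweeney 2026, Prop. 1.2, after Lawson–Michelsohn, Invent. Math. 77
(1984)): the GEOMETRIC bridge from the Euclidean form of Lawson–Michelsohn's surrounding theorem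
(the tree's fact `LawsonMichelsohn1984_surrounding`: a compact domain of `ℝⁿ⁺¹` isotopic to one
whose boundary has positive FLAT mean curvature) to the conclusion of Sweeney's proposition
(positive scalar curvature AND mean-convex boundary). PROVED here
(`pscMeanConvex_of_flatMeanConvexImmersion`): if a compact `(n+1)`-manifold with boundary `X`,
`n ≥ 1`, is immersed in codimension `0` into `ℝⁿ⁺¹` by `ι` (smooth, injective differentials) and
along the boundary `ι ∘ incl` an ambient vector field `Y` (think `∇F/‖∇F‖`) is a flat unit normal,
smooth near the image, outward (`(dι)⁻¹ Y` has negative `0`-th half-space coordinate) and of flat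
mean curvature `H ≥ H₀ > 0` (tree convention `K(v, w) = ⟪D_v Y, d(ι∘incl) w⟫`, `H = tr K`), then
`X` carries a Riemannian metric with Levi-Civita connection and positive scalar curvature for
which `incl` is a spacelike immersion with a smooth outward unit normal of positive mean curvature.

The metric is `ι^* ĝ` for `ĝ = λ_R² δ`, the round metric of the unit `Sⁿ⁺¹` pulled back to `ℝⁿ⁺¹`
by the scaled inverse stereographic map `x ↦ σ⁻¹(x/R)` (`StereographicConformal.lean`:
`stereoMetric`, scalar curvature `n(n+1) > 0`, `λ_R(x) = 4R/(‖x‖² + 4R²)`), with `R = nC/H₀ + 1`,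
`C ≥ ‖ι ∘ incl‖`: the rescaled normal `λ_R⁻¹ Y` is a `ĝ`-unit normal, still outward, and by the
conformal change formula (`HypersurfaceConformal.lean`, `meanCurvature_comp_conformal`)
`Ĥ = H/λ_R + n · dλ_R(Y)/λ_R² = ((‖x‖² + 4R²) H - 2n⟪x, Y⟫)/(4R) ≥ (4R² H₀ - 2nC)/(4R) > 0`;
conclude by `pscMeanConvex_of_immersion` (`MeanConvexContractibleProofs.lean`). Also
`isSpacelikeImmersion_euclidean_comp_incl` (the boundary is flat-spacelike) and
`contDiff_stereoFactor`. No named facts.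

## References

* P. Sweeney Jr., *Positive curvature conditions on contractible manifolds*, Math. Ann. (2026)
  = arXiv:2507.15719, Prop. 1.2 (p. 4). [Sweeney2026]
* H. B. Lawson, M.-L. Michelsohn, *Embedding and surrounding with positive mean curvature*,
  Invent. Math. 77 (1984) 399–419, Thm. (6.1) with `M̄ = ℝⁿ⁺¹`. [LawsonMichelsohn1984]
* A. L. Besse, *Einstein manifolds* (1987), Thm. 1.159 (conformal changes). [Besse1987]
-/

noncomputable section

open Bundle Set Function Metric Module Filter
open scoped Manifold ContDiff Topology RealInnerProductSpace

namespace Literature.Geometry.Riemannian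

open Lorentzian Lorentzian.PseudoRiemannianMetric

variable {V : Type*} [NormedAddCommGroup V] [InnerProductSpace ℝ V] {n : ℕ}

/-- Local notation: the model space `ℝⁿ⁺¹`. -/
local notation "𝔼" => EuclideanSpace ℝ (Fin (n + 1))

/-! ### Flat mean-convex immersions: positive scalar curvature with mean-convex boundary by a big sphere -/

section FlatImmersion

open Literature.Topology.FourManifolds

omit [InnerProductSpace ℝ V] in
/-- The conformal factor is smooth for `R ≠ 0`. [folklore] -/
theorem contDiff_stereoFactor {R : ℝ} (hR : R ≠ 0) : ContDiff ℝ ∞ (stereoFactor (n := n) R) := by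
  unfold stereoFactor
  refine contDiff_const.div ((contDiff_norm_sq ℝ).add contDiff_const) fun x ↦ ?_
  positivity

variable (n)

/-- **The immersed boundary of a codimension-`0` immersion into `ℝⁿ⁺¹` is a spacelike immersion for
the Euclidean metric.** [folklore] -/
theorem isSpacelikeImmersion_euclidean_comp_incl {X : Type*} [TopologicalSpace X]
    [ChartedSpace (EuclideanHalfSpace (n + 1)) X] [IsManifold (𝓡∂ (n + 1)) ∞ X]
    (bX : BoundaryData (𝓡∂ (n + 1)) X (𝓡 n)) {ι : X → 𝔼}
    (hι : ContMDiff (𝓡∂ (n + 1)) 𝓘(ℝ, 𝔼) ∞ ι)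
    (hι' : ∀ x, Injective (mfderiv (𝓡∂ (n + 1)) 𝓘(ℝ, 𝔼) ι x)) :
    (euclideanMetric 𝔼).IsSpacelikeImmersion (𝓡 n) (ι ∘ bX.incl) := by
  have hincl : ContMDiff (𝓡 n) (𝓡∂ (n + 1)) ∞ bX.incl := bX.isSmoothEmbedding.contMDiff
  refine ⟨hι.comp hincl, fun z v hv ↦ ?_⟩
  rw [inducedBilin_apply, euclideanMetric_apply]
  refine real_inner_self_pos.2 fun h0 ↦ hv ?_
  have hincl_inj : Injective (mfderiv (𝓡 n) (𝓡∂ (n + 1)) bX.incl z) :=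
    Literature.Topology.FourManifolds.Manifold.IsImmersionAt.mfderiv_injective
      (bX.isSmoothEmbedding.isImmersion.isImmersionAt z) (by simp)
  rw [mfderiv_comp z ((hι _).mdifferentiableAt (by simp)) ((hincl z).mdifferentiableAt (by simp))] at h0
  exact hincl_inj ((hι' _ (h0.trans (map_zero _).symm)).trans (map_zero _).symm)

/-- **A compact manifold with boundary immersed in codimension `0` into `ℝⁿ⁺¹` with mean-convex
boundary carries a metric of positive scalar curvature with mean-convex boundary** — the
conclusion of `Literature.Geometry.Riemannian.Sweeney2026_pscMeanConvex` for `X`. Here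
`ι : X → ℝⁿ⁺¹` is smooth with injective differentials, and along the boundary `ι ∘ incl` there is
an ambient vector field `Y` (e.g. `∇F/‖∇F‖` for a defining function) which is a flat unit normal,
smooth near the image, OUTWARD (`(dι)⁻¹ Y` has negative `0`-th half-space coordinate in the charts
of `X`) and of flat mean curvature `H ≥ H₀ > 0` (`H = tr K`, `K(v,w) = ⟪D_v Y, d(ι∘incl) w⟫`, the
tree's convention, so that round balls are mean convex for the outer normal). This is the "big
sphere" step turning the output of Lawson–Michelsohn's Euclidean surrounding theorem (a compact
domain of `ℝⁿ⁺¹` with `H > 0` boundary, `LawsonMichelsohn1984_surrounding`) into the input of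
Sweeney's Prop. 1.2: replace the flat metric by `ĝ = λ_R² δ`, the round metric of `Sⁿ⁺¹` pulled back
by `x ↦ σ⁻¹(x/R)` (`StereographicConformal.lean`; positive scalar curvature `n(n+1)`), for `R`
large; the rescaled normal `λ_R⁻¹ Y` is a `ĝ`-unit normal, still outward, of mean curvature
`Ĥ = H/λ_R + n dλ_R(Y)/λ_R² = ((‖x‖² + 4R²) H - 2n⟪x, Y⟫)/(4R) ≥ (4R² H₀ - 2nC)/(4R) > 0` for
`R = nC/H₀ + 1`, `C = max ‖ι ∘ incl‖` (`HypersurfaceConformal.lean`); then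
`pscMeanConvex_of_immersion` (`MeanConvexContractibleProofs.lean`). [cite: Sweeney2026, Prop. 1.2] -/
theorem pscMeanConvex_of_flatMeanConvexImmersion (hn : 1 ≤ n) (X : Type*) [TopologicalSpace X]
    [ChartedSpace (EuclideanHalfSpace (n + 1)) X] [IsManifold (𝓡∂ (n + 1)) ∞ X] [CompactSpace X]
    (bX : BoundaryData (𝓡∂ (n + 1)) X (𝓡 n)) [(euclideanMetric 𝔼).HasLeviCivita]
    {ι : X → 𝔼} (hι : ContMDiff (𝓡∂ (n + 1)) 𝓘(ℝ, 𝔼) ∞ ι)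
    (hι' : ∀ x, Injective (mfderiv (𝓡∂ (n + 1)) 𝓘(ℝ, 𝔼) ι x))
    {Y : 𝔼 → 𝔼} (hY : ∀ z : bX.carrier, ContDiffAt ℝ ∞ Y (ι (bX.incl z)))
    (hunit : ∀ z, ‖Y (ι (bX.incl z))‖ = 1)
    (hnormal : ∀ z (w : TangentSpace (𝓡 n) z),
      ⟪Y (ι (bX.incl z)), mfderiv (𝓡 n) 𝓘(ℝ, 𝔼) (ι ∘ bX.incl) z w⟫ = 0)
    (hout : ∀ z, (show 𝔼 from
      (mfderiv (𝓡∂ (n + 1)) 𝓘(ℝ, 𝔼) ι (bX.incl z)).inverse (Y (ι (bX.incl z)))) 0 < 0)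
    (hH : ∃ H₀ : ℝ, 0 < H₀ ∧ ∀ z, H₀ ≤ (euclideanMetric 𝔼).meanCurvature (ι ∘ bX.incl)
      contMDiff_pullbackBilin_holds (isSpacelikeImmersion_euclidean_comp_incl n bX hι hι')
        (fun z ↦ Y (ι (bX.incl z))) z) :
    ∃ g : PseudoRiemannianMetric (𝓡∂ (n + 1)) ∞ (EuclideanSpace ℝ (Fin (n + 1)))
        (TangentSpace (𝓡∂ (n + 1)) : X → Type _),
    ∃ _ : g.HasLeviCivita, ∃ hf : g.IsSpacelikeImmersion (𝓡 n) bX.incl,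
    ∃ ν : NormalField (𝓡∂ (n + 1)) bX.incl,
      g.IsRiemannian ∧ (∀ x, 0 < g.scalarCurvature x) ∧ g.IsUnitNormal (𝓡 n) bX.incl ν 1 ∧
      ContMDiff (𝓡 n) (𝓡∂ (n + 1)).tangent ∞
        (fun z ↦ (TotalSpace.mk' (EuclideanSpace ℝ (Fin (n + 1))) (bX.incl z) (ν z) :
          TangentBundle (𝓡∂ (n + 1)) X)) ∧
      (∀ z, (show EuclideanSpace ℝ (Fin (n + 1)) from ν z) 0 < 0) ∧
      ∀ z, 0 < g.meanCurvature bX.incl contMDiff_pullbackBilin_holds hf ν z := by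
  have hincl : ContMDiff (𝓡 n) (𝓡∂ (n + 1)) ∞ bX.incl := bX.isSmoothEmbedding.contMDiff
  have hf : ContMDiff (𝓡 n) 𝓘(ℝ, 𝔼) ∞ (ι ∘ bX.incl) := hι.comp hincl
  -- a bound for the image of the boundary
  haveI : CompactSpace bX.carrier := bX.compactSpace_carrier
  obtain ⟨C, hC0, hC⟩ : ∃ C : ℝ, 0 ≤ C ∧ ∀ z, ‖ι (bX.incl z)‖ ≤ C := by
    obtain ⟨C, hC⟩ := (isCompact_range (hf.continuous.norm)).isBounded.subset_closedBall_lt 0 0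
    exact ⟨C, hC.1.le, fun z ↦ by simpa using hC.2 (mem_range_self z)⟩
  obtain ⟨H₀, hH₀, hHle⟩ := hH
  -- the radius of the big sphere
  set R : ℝ := n * C / H₀ + 1 with hR_def
  have hnC : 0 ≤ (n : ℝ) * C / H₀ := by positivity
  have hR1 : 1 ≤ R := by linarith
  have hR0 : 0 < R := by linarith
  have hRH : (n : ℝ) * C < R * H₀ := by
    have : R * H₀ = n * C + H₀ := by
      rw [hR_def, add_mul, div_mul_cancel₀ _ hH₀.ne', one_mul]
    linarith
  -- the conformally flat metric `ĝ = λ_R² δ`, isometric to a punctured round sphere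
  haveI : Fact (finrank ℝ (EuclideanSpace ℝ (Fin (n + 1 + 1))) = n + 1 + 1) :=
    ⟨finrank_euclideanSpace_fin⟩
  set v : sphere (0 : EuclideanSpace ℝ (Fin (n + 1 + 1))) 1 := ⟨EuclideanSpace.single 0 1, by simp⟩
  haveI := (roundMetric (n := n + 1) (EuclideanSpace ℝ (Fin (n + 1 + 1)))).hasLeviCivita
  haveI := (stereoMetric (n := n) v hR0.ne').hasLeviCivita
  have hval := stereoMetric_val_eq_smul (n := n) v hR0.ne'
  have hpos : ∀ x : 𝔼, 0 < stereoFactor (n := n) R x := stereoFactor_pos hR0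
  have hflat := isSpacelikeImmersion_euclidean_comp_incl n bX hι hι'
  have hgM : (stereoMetric (n := n) v hR0.ne').IsRiemannian := fun x a ha ↦ by
    rw [stereoMetric_apply]
    exact mul_pos (pow_pos (hpos x) 2) (real_inner_self_pos.2 ha)
  have hunit' : (euclideanMetric 𝔼).IsUnitNormal (𝓡 n) (ι ∘ bX.incl) (fun z ↦ Y (ι (bX.incl z))) 1 := by
    refine ⟨fun z w ↦ ?_, fun z ↦ ?_⟩
    · rw [euclideanMetric_apply]; exact hnormal z w
    · rw [euclideanMetric_apply]
      change ⟪Y (ι (bX.incl z)), Y (ι (bX.incl z))⟫ = (1 : ℝ)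
      rw [real_inner_self_eq_norm_sq, hunit, one_pow]
  refine pscMeanConvex_of_immersion n X bX (stereoMetric (n := n) v hR0.ne') hgM hι hι'
    (fun x ↦ scalarCurvature_stereoMetric_pos v hR0.ne' hn _)
    (hflat.conformal hval fun z ↦ (hpos _).ne')
    (νM := fun z ↦ (stereoFactor (n := n) R (ι (bX.incl z)))⁻¹ • Y (ι (bX.incl z)))
    (isUnitNormal_conformal hval hunit' fun z ↦ hpos _) (fun z ↦ ?_) (fun z ↦ ?_) (fun z ↦ ?_)
  · -- smoothness of the rescaled normal (a `Tℝⁿ⁺¹`-valued map: componentwise)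
    rw [ModelWithCorners.tangent, contMDiffAt_totalSpace]
    refine ⟨hf z, ?_⟩
    have h1 : ContDiffAt ℝ ∞ (fun p ↦ (stereoFactor (n := n) R p)⁻¹ • Y p) (ι (bX.incl z)) :=
      (((contDiff_stereoFactor hR0.ne').contDiffAt).inv (hpos _).ne').smul (hY z)
    refine (h1.contMDiffAt.comp z (hf z)).congr_of_eventuallyEq (Eventually.of_forall fun w ↦ ?_)
    beta_reduce
    rw [trivializationAt_model_space_apply]
    rfl
  · -- outwardness: `(dι)⁻¹ (λ⁻¹ Y) = λ⁻¹ (dι)⁻¹ Y`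
    have h := hout z
    change WithLp.ofLp ((mfderiv (𝓡∂ (n + 1)) 𝓘(ℝ, 𝔼) ι (bX.incl z)).inverse
      (Y (ι (bX.incl z)))) 0 < 0 at h
    have e := ((mfderiv (𝓡∂ (n + 1)) 𝓘(ℝ, 𝔼) ι (bX.incl z)).inverse).map_smul
      (stereoFactor (n := n) R (ι (bX.incl z)))⁻¹ (Y (ι (bX.incl z)))
    have key := congrArg (fun u : 𝔼 ↦ WithLp.ofLp u 0) e
    calc WithLp.ofLp ((mfderiv (𝓡∂ (n + 1)) 𝓘(ℝ, 𝔼) ι (bX.incl z)).inverse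
        ((stereoFactor (n := n) R (ι (bX.incl z)))⁻¹ • Y (ι (bX.incl z)))) 0
        = (stereoFactor (n := n) R (ι (bX.incl z)))⁻¹ *
          WithLp.ofLp ((mfderiv (𝓡∂ (n + 1)) 𝓘(ℝ, 𝔼) ι (bX.incl z)).inverse (Y (ι (bX.incl z)))) 0 :=
          key.trans rfl
      _ < 0 := mul_neg_of_pos_of_neg (inv_pos.2 (hpos _)) h
  · -- positivity of the mean curvature for `ĝ`
    have hY' : MDifferentiableAt 𝓘(ℝ, 𝔼) (𝓘(ℝ, 𝔼).tangent)
        (fun x : 𝔼 ↦ (TotalSpace.mk' 𝔼 x (Y x) : TangentBundle 𝓘(ℝ, 𝔼) 𝔼)) (ι (bX.incl z)) := by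
      rw [ModelWithCorners.tangent, mdifferentiableAt_section]
      simp only [trivializationAt_model_space_apply]
      exact ((hY z).differentiableAt (by simp)).mdifferentiableAt
    have hnormal' : ∀ w : TangentSpace (𝓡 n) z, (euclideanMetric 𝔼).val ((ι ∘ bX.incl) z)
        (Y ((ι ∘ bX.incl) z)) (mfderiv (𝓡 n) 𝓘(ℝ, 𝔼) (ι ∘ bX.incl) z w) = 0 := fun w ↦ by
      rw [euclideanMetric_apply]; exact hnormal z w
    have hĤ := meanCurvature_comp_conformal (g := euclideanMetric 𝔼) hval contMDiff_pullbackBilin_holds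
      hflat (fun z ↦ (hpos _).ne') (BoundarylessManifold.isInteriorPoint (x := z)) hY'
      (mdifferentiableAt_stereoFactor R _) hnormal'
    rw [finrank_euclideanSpace_fin, mvfderiv_stereoFactor] at hĤ
    refine lt_of_lt_of_eq ?_ hĤ.symm
    simp only [Function.comp_apply]
    set x : 𝔼 := ι (bX.incl z) with hx
    set Hz := (euclideanMetric 𝔼).meanCurvature (ι ∘ bX.incl) contMDiff_pullbackBilin_holds hflat
      (fun z ↦ Y (ι (bX.incl z))) z with hHz
    have hq : 0 < ‖x‖ ^ 2 + 4 * R ^ 2 := by positivity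
    have hxC : ‖x‖ ≤ C := hC z
    have hs : ⟪x, Y x⟫ ≤ C := (real_inner_le_norm _ _).trans (by rw [hunit z, mul_one]; exact hxC)
    have hHz0 : H₀ ≤ Hz := hHle z
    have key : 0 < (‖x‖ ^ 2 + 4 * R ^ 2) * Hz - 2 * n * ⟪x, Y x⟫ := by
      have hHz_nn : 0 ≤ Hz := hH₀.le.trans hHz0
      have hq4 : 4 * R ^ 2 ≤ ‖x‖ ^ 2 + 4 * R ^ 2 := by nlinarith [sq_nonneg ‖x‖]
      have h1 : 4 * R ^ 2 * H₀ ≤ (‖x‖ ^ 2 + 4 * R ^ 2) * Hz :=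
        (mul_le_mul_of_nonneg_left hHz0 (by positivity)).trans
          (mul_le_mul_of_nonneg_right hq4 hHz_nn)
      have h2 : 2 * (n : ℝ) * ⟪x, Y x⟫ ≤ 2 * n * C := mul_le_mul_of_nonneg_left hs (by positivity)
      have hRR : R ≤ R ^ 2 := by nlinarith [mul_nonneg (sub_nonneg.2 hR1) hR0.le]
      have h3 : R * H₀ ≤ R ^ 2 * H₀ := mul_le_mul_of_nonneg_right hRR hH₀.le
      nlinarith [hRH, h1, h2, h3, hC0]
    have hform : (stereoFactor (n := n) R x)⁻¹ * Hz +
        n * (-(8 * R * ⟪x, Y x⟫) / (‖x‖ ^ 2 + 4 * R ^ 2) ^ 2) / stereoFactor (n := n) R x ^ 2 =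
        ((‖x‖ ^ 2 + 4 * R ^ 2) * Hz - 2 * n * ⟪x, Y x⟫) / (4 * R) := by
      unfold stereoFactor
      field_simp
      ring
    rw [hform]
    exact div_pos key (by positivity)


end FlatImmersion

end Literature.Geometry.Riemannian

end
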